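import Summits.CriticalPhenomena.PercolationContinuityZ3.Theorems.PercNearOneGluingNoHeavyPcintNawFreeMemKernelClaims
import HarnessLib

/-!
# PCINT lane, reduction B2d on the dangerous-set automaton — PACKED literal form of the claims certificate

Cell `prim-pcint` (PAPER-2 track (iii)), seat `prim-pcint-1` (gen 8); support file (`--supports stmt-CriticalPhenomena-4575`).
Does NOT build on p205010.  Memo: prim-pcint-1/gen8/README.md ("Kernel cost anatomy": the literal, not the check, is the bottleneck
of a memory-16 row; packing halves it).

A `NawK.PT` table stores every row datum as natural numbers — an element `(r, a)` of a state (`r ∈ ℤ^d` with coordinates in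
`[-32, 31]`, age `a < 64`) as `(Σ_i (r_i + 32) 64^{d-1-i}) · 64 + a`, a successor datum `some (j, s)` as `j · 64 + s + 1` (`0` for
`none`), a claim `(w, np, cn)` as `(code w · 4 + np) · 16 + cn` — and `NawK.PT.toWT` DECODES it into the `NawK.WT` table of
`…NawFreeMemKernelClaims`.  Nothing is proved here: an instance runs `NawK.checkRowW … pt.toWT` (the kernel unfolds the decoding
lazily, row by row) and applies `NawK.le_siteCriticalProb_of_checkRowsW` to `pt.toWT` verbatim.
-/

namespace Summit.CriticalPhenomena.PercolationContinuityZ3.Theorems.Pcint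

namespace NawK

/-- Packed row payload: weight, packed state, packed successor data, packed claims per letter (unconditional codes, corner code
or `0`). [folklore] -/
abbrev PayloadP : Type := ℕ × List ℕ × List ℕ × List (List ℕ × ℕ)

/-- Packed certificate table. [folklore] -/
inductive PT where
  | leaf : PT
  | node : PT → ℕ → PayloadP → PT → PT

/-- Decode the coordinates of a site code (most significant first), `d` digits in base `64`, offset `32`. [folklore] -/
def decSite (d : ℕ) (c : ℕ) : List ℤ :=
  ((List.range d).reverse.map fun i => ((c / 64 ^ i % 64 : ℕ) : ℤ) - 32)

/-- Decode a state element `(site, age)`. [folklore] -/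
def decEl (d : ℕ) (c : ℕ) : List ℤ × ℕ := (decSite d (c / 64), c % 64)

/-- Decode a successor datum. [folklore] -/
def decSucc (c : ℕ) : Option (ℕ × ℕ) := if c = 0 then none else some ((c - 1) / 64, (c - 1) % 64)

/-- Decode a claim `(site, np, cn)`. [folklore] -/
def decClaim (d : ℕ) (c : ℕ) : UClaim := (decSite d (c / 64), c / 16 % 4, c % 16)

/-- Decode the claims of one letter (corner code `0` = no corner claim). [folklore] -/
def decLClaims (d : ℕ) (x : List ℕ × ℕ) : LClaims :=
  (x.1.map (decClaim d), if x.2 = 0 then none else some (decClaim d x.2))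

/-- Decode a payload. [folklore] -/
def decPayload (d : ℕ) (v : PayloadP) : PayloadW :=
  (v.1, v.2.1.map (decEl d), v.2.2.1.map decSucc, v.2.2.2.map (decLClaims d))

/-- Decode a packed table into a claims table (lazily unfolded by the kernel). [folklore] -/
def PT.toWT (d : ℕ) : PT → WT
  | PT.leaf => WT.leaf
  | PT.node l k v r => WT.node (l.toWT d) k (decPayload d v) (r.toWT d)

end NawK

end Summit.CriticalPhenomena.PercolationContinuityZ3.Theorems.Pcint
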